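import Literature.MathematicalPhysics.QuantumLattice.HubbardSliceSymbolDifferences
import Literature.Probability.LatticeModels.TorusAdditiveWeightSum
import Literature.Probability.LatticeModels.TorusFourierWeightedL1Prod
import HarnessLib

/-!
# The `L¹` norm of a shifted Salmhofer slice on the time grid: `α_j ≤ C_r (N/β) Λ^{-3/2}` (sector-free, sharp in `β`)

Topic `MathematicalPhysics/QuantumLattice`; assembly of R0-SCOPE-4 W2 (cell gate-hubbard-kl).  For the slice `C^θ_{(Λ,Λ′]}` of the
shifted Hubbard covariance (`hubbardCovSliceShifted`, `π/β ≤ Λ ≤ Λ′ ≤ rΛ`, `Λ ≤ 1`, `Λ′ ≤ d₀/4`) pulled back to the fields on the grid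
`{jβ/N} × (ℤ/L)²` (`hubbardGridSub`, `2M ≤ N`), every row and every column sum of `|Sᵀ C S|` is at most

`C · (N/β) · Λ^{-3/2}`,   `C = C(r, d₀)` independent of `β, L, M, N, Λ` (`Λβ ≤ N`, `Λ′L ≥ 2π√(d₀/8)`, `Λ′ < π(2M-3)/β`),

— the sharp sector-free power counting `‖g^{(h)}‖_{L¹} ≲ γ^{-3h/2}` of Benfatto–Giuliani–Mastropietro 2006, Lemma 2.2 / footnote ¹ at
finite `(β, L)`, with the factor `N/β` of the grid density.  Route: rows are `ℓ¹` norms of product-torus character sums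
(`HubbardGridCharacters`), priced by the weighted Plancherel inequality `TorusFourierWeightedL1Prod.sum_sum_norm_prodChar_le` with SECOND
differences and the additive weight `1 + (Λτ)⁴ + (Λx₁)⁴ + (Λx₂)⁴` (`TorusAdditiveWeightSum`: `Σ W⁻¹ ≲ N/(βΛ³)`), the `ℓ²` inputs being those of
`HubbardSliceSymbolDifferences` (`≲ N r²/β` after the phase-space count).

* `weight_eq` — the weight of `sum_sum_norm_prodChar_le` for `u = 1`, `v_i = e_i`, `c₀ = (s₀N/4)⁴`, `c_i = (tL/4)⁴` is the additive weight;
* **`exists_rowSum_sliceShifted_le`** — `∃ C > 0` (depending on `r, d₀` only) bounding all row and column sums by `C (N/β)/(Λ√Λ)`.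

Everything is proved; no definitions, no named facts.

## Sources

G. Benfatto, A. Giuliani, V. Mastropietro, Ann. Henri Poincaré 7 (2006) 809–898, Lemma 2.2, (2.36aa), (2.81) and footnote ¹
(`BenfattoGiulianiMastropietro2006`); M. Salmhofer, *Renormalization* (1999), §4.2.5 (`Salmhofer1999`).
-/

noncomputable section

namespace Literature.MathematicalPhysics.QuantumLattice

open Literature.Probability.LatticeModels Finset Complex GrassmannAlgebra

variable {L M N : ℕ} [NeZero L] [NeZero N]

/-- The weight of `sum_sum_norm_prodChar_le` for the time direction `u = 1`, the space directions `e_i`, second differences and the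
constants `c₀ = (s₀N/4)⁴`, `c_i = (tL/4)⁴` is the additive weight `1 + (s₀|ã|)⁴ + Σ_i (t|b̃_i|)⁴`.
[cite: BenfattoGiulianiMastropietro2006, Lemma 2.2 and footnote 1] -/
theorem weight_eq (s₀ t : ℝ) (a : TorusSite 1 N) (b : TorusSite 2 L) :
    1 + (s₀ * N / 4) ^ 4 * (4 * |(((∑ j, (fun _ : Fin 1 => (1 : ZMod N)) j * a j).valMinAbs : ℤ) : ℝ)| / N) ^ (2 * 2) +
        ∑ i ∈ (univ : Finset (Fin 2)), (t * L / 4) ^ 4 *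
          (4 * |(((∑ j, (Pi.single i (1 : ZMod L) : TorusSite 2 L) j * b j).valMinAbs : ℤ) : ℝ)| / L) ^ (2 * 2) =
      1 + (s₀ * |(((a 0).valMinAbs : ℤ) : ℝ)|) ^ 4 + ∑ i, (t * |(((b i).valMinAbs : ℤ) : ℝ)|) ^ 4 := by
  have hN : (N : ℝ) ≠ 0 := by exact_mod_cast NeZero.ne N
  have hL : (L : ℝ) ≠ 0 := by exact_mod_cast NeZero.ne L
  have ha : ∑ j, (fun _ : Fin 1 => (1 : ZMod N)) j * a j = a 0 := by simp
  have hb : ∀ i : Fin 2, ∑ j, (Pi.single i (1 : ZMod L) : TorusSite 2 L) j * b j = b i := by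
    intro i
    rw [Finset.sum_eq_single i (fun j _ hj => by rw [Pi.single_eq_of_ne hj, zero_mul]) (fun h => absurd (mem_univ i) h),
      Pi.single_eq_same, one_mul]
  simp_rw [ha, hb]
  simp only [show (2 * 2 : ℕ) = 4 from rfl]
  congr 1
  · congr 1
    rw [← mul_pow]
    congr 1
    field_simp
  · refine sum_congr rfl fun i _ => ?_
    rw [← mul_pow]
    congr 1
    field_simp

/-- **The `L¹` norm of a shifted slice on the grid** (Benfatto–Giuliani–Mastropietro 2006, Lemma 2.2 / (2.81), sector-free, at finite
`(β, L)` on the `N`-point time grid): for every ratio bound `r ≥ 1` and band-structure margin `d₀ > 0` there is `C > 0` such that for all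
`L, M, N, β, μ, θ, Λ, Λ′` with `0 < β`, `μ` at distance `≥ d₀` from `{-4, 0}`, `|βθ| ≤ π/4`, `π/β ≤ Λ ≤ 1`, `Λ ≤ Λ′ ≤ rΛ`, `Λ′ ≤ d₀/2`,
`Λ′ < π(2M-3)/β`, `2 ≤ M`, `2M ≤ N`, `Λβ ≤ N`, `2π√(d₀/8) ≤ Λ′L`, every row and every column sum of the pulled-back slice covariance
`Sᵀ C^θ_{(Λ,Λ′]} S` over the grid legs is at most `C · (N/β) / (Λ√Λ)`. [cite: BenfattoGiulianiMastropietro2006, Lemma 2.2 (2.81)] -/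
theorem exists_rowSum_sliceShifted_le {d₀ r : ℝ} (hd₀ : 0 < d₀) (hr : 1 ≤ r) :
    ∃ C : ℝ, 0 < C ∧ ∀ (L M N : ℕ) [NeZero L] [NeZero N] (β μ θ Λ Λ' : ℝ),
      0 < β → d₀ ≤ μ + 4 → d₀ ≤ -μ → |β * θ| ≤ Real.pi / 4 → Real.pi / β ≤ Λ → Λ ≤ 1 → Λ ≤ Λ' → Λ' ≤ r * Λ →
      Λ' ≤ d₀ / 2 → Λ' < Real.pi * (2 * M - 3) / β → 2 * M ≤ N → 2 ≤ M → Λ * β ≤ N →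
      2 * Real.pi * Real.sqrt (d₀ / 8) ≤ Λ' * L →
      (∀ X : GridLeg (GridPoint L N), ∑ Y, ‖((hubbardGridSub L M β N).transpose * hubbardCovSliceShifted L M β μ θ Λ Λ' *
          hubbardGridSub L M β N) X Y‖ ≤ C * (N / β) / (Λ * Real.sqrt Λ)) ∧
      (∀ Y : GridLeg (GridPoint L N), ∑ X, ‖((hubbardGridSub L M β N).transpose * hubbardCovSliceShifted L M β μ θ Λ Λ' *
          hubbardGridSub L M β N) X Y‖ ≤ C * (N / β) / (Λ * Real.sqrt Λ)) := by
  obtain ⟨B₁, B₂, hB₁0, hB₂0, hB₁, hB₂⟩ := exists_deriv_bounds_salmhoferCutoff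
  -- the constants
  set K₁ : ℝ := 32 * B₂ + 144 * B₁ + 128 with hK₁
  set K₂ : ℝ := 128 * B₂ + 608 * B₁ + 544 with hK₂
  set Ktot : ℝ := 64 / 9 + 3 * (2 * Real.pi) ^ 4 * K₁ ^ 2 / 256 + 6 * (2 * Real.pi) ^ 4 * K₂ ^ 2 / 256 with hKtot
  set cd : ℝ := 2 * Real.pi * Real.sqrt (d₀ / 8) with hcd
  have hcd0 : 0 < cd := by rw [hcd]; positivity
  have hKtot0 : 0 < Ktot := by rw [hKtot]; positivity
  set C : ℝ := Real.sqrt (2744 * (32 * r ^ 2 * Ktot / (Real.pi * cd))) with hC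
  have hC0 : 0 < C := by rw [hC]; positivity
  clear_value K₁ K₂ Ktot cd C
  refine ⟨C, hC0, ?_⟩
  intro L M N _ _ β μ θ Λ Λ' hβ hμ4 hμ0 hθ hΛβ hΛ1 hΛΛ' hΛ'r hΛ'd hM hMN hM2 hNβ hLd
  have hΛ : 0 < Λ := lt_of_lt_of_le (by positivity) hΛβ
  have hΛ' : 0 < Λ' := hΛ.trans_le hΛΛ'
  have hL0 : (0 : ℝ) < L := by exact_mod_cast Nat.pos_of_ne_zero (NeZero.ne L)
  have hN0 : (0 : ℝ) < N := by exact_mod_cast Nat.pos_of_ne_zero (NeZero.ne N)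
  have hM1 : Λ' < Real.pi * (2 * M + 1) / β :=
    hM.trans_le (div_le_div_of_nonneg_right (mul_le_mul_of_nonneg_left (by linarith) Real.pi_pos.le) hβ.le)
  have hθ' : |θ| ≤ Real.pi / (4 * β) := by
    rw [abs_mul, abs_of_pos hβ] at hθ
    rw [le_div_iff₀ (by positivity)]; linarith
  have hΛ'β : Real.pi ≤ Λ' * β := by
    have := (div_le_iff₀ hβ).1 (hΛβ.trans hΛΛ'); linarith
  -- scalar preliminaries (small context: keep `linarith` cheap)
  set s₀ : ℝ := Λ * β / N with hs₀
  have hs₀0 : 0 < s₀ := by rw [hs₀]; positivity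
  have hP : ∑ a : TorusSite 1 N, ∑ b : TorusSite 2 L,
      (1 + (s₀ * |(((a 0).valMinAbs : ℤ) : ℝ)|) ^ 4 + ∑ i, (Λ * |(((b i).valMinAbs : ℤ) : ℝ)|) ^ 4)⁻¹ ≤
        2744 * N / (β * Λ ^ 3) := by
    refine (sum_inv_additiveWeight_le hs₀0 (fun _ : Fin 2 => Λ) fun _ => hΛ).trans ?_
    rw [Fin.prod_const]
    have h1 : 2 + 12 / s₀ ≤ 14 * N / (Λ * β) := by
      have e1 : 12 / s₀ = 12 * N / (Λ * β) := by rw [hs₀]; field_simp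
      have e2 : (2 : ℝ) ≤ 2 * N / (Λ * β) := by
        rw [le_div_iff₀ (by positivity)]; linarith only [hNβ]
      rw [e1]
      have e3 : 2 * N / (Λ * β) + 12 * N / (Λ * β) = 14 * N / (Λ * β) := by ring
      linarith only [e2, e3]
    have h2 : 2 + 12 / Λ ≤ 14 / Λ := by
      have e2 : (2 : ℝ) ≤ 2 / Λ := by rw [le_div_iff₀ hΛ]; linarith only [hΛ1]
      have e3 : 2 / Λ + 12 / Λ = 14 / Λ := by ring
      linarith only [e2, e3]
    calc (2 + 12 / s₀) * (2 + 12 / Λ) ^ 2 ≤ (14 * N / (Λ * β)) * (14 / Λ) ^ 2 :=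
          mul_le_mul h1 (pow_le_pow_left₀ (by positivity) h2 2) (by positivity) (by positivity)
      _ = 2744 * N / (β * Λ ^ 3) := by field_simp; ring
  have hc2 : ‖((1 / (β * (L : ℝ) ^ 2) : ℝ) : ℂ)‖ ^ 2 = 1 / (β * (L : ℝ) ^ 2) ^ 2 := by
    rw [Complex.norm_real, Real.norm_eq_abs, abs_of_pos (by positivity)]; ring
  set Fw : ℝ := Λ' * β / Real.pi + 3 with hFw
  set Sh : ℝ := 4 * (L * (Λ' * L / (2 * Real.pi * Real.sqrt (d₀ / 8)) + 1)) with hSh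
  have hFw_le : Fw ≤ 4 * Λ' * β / Real.pi := by
    rw [hFw]
    have hx : 1 ≤ Λ' * β / Real.pi := by rw [one_le_div Real.pi_pos]; exact hΛ'β
    have h4 : Λ' * β / Real.pi + 3 ≤ 4 * (Λ' * β / Real.pi) := by linarith only [hx]
    exact h4.trans (le_of_eq (by ring))
  have hSh_le : Sh ≤ 8 * Λ' * (L : ℝ) ^ 2 / cd := by
    rw [hSh, ← hcd]
    have h1 : 1 ≤ Λ' * L / cd := by rw [one_le_div hcd0]; exact hLd
    have h2 : Λ' * L / cd + 1 ≤ 2 * (Λ' * L / cd) := by linarith only [h1]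
    have : (L : ℝ) * (Λ' * L / cd + 1) ≤ L * (2 * (Λ' * L / cd)) := mul_le_mul_of_nonneg_left h2 hL0.le
    calc 4 * (L * (Λ' * L / cd + 1)) ≤ 4 * (L * (2 * (Λ' * L / cd))) := by linarith only [this]
      _ = 8 * Λ' * (L : ℝ) ^ 2 / cd := by field_simp; ring
  have hFwSh : Fw * Sh ≤ (4 * Λ' * β / Real.pi) * (8 * Λ' * (L : ℝ) ^ 2 / cd) :=
    mul_le_mul hFw_le hSh_le (by positivity) (by positivity)
  clear_value Fw Sh
  -- the `ℓ¹` norm of the character sums, for each spin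
  have hA : ∀ σ : Fin 2, ∑ a : TorusSite 1 N, ∑ bv : TorusSite 2 L,
      ‖∑ q₀ : TorusSite 1 N, ∑ qv : TorusSite 2 L, torusChar q₀ a * torusChar qv bv *
        gridSymbol L M N β (shiftedSliceSymbol L M β μ θ Λ Λ') σ q₀ qv‖ ≤ C * (N / β) / (Λ * Real.sqrt Λ) := by
    intro σ
    have hE0 := sum_norm_sq_gridSymbol_shiftedSlice_le (L := L) (M := M) (N := N) (μ := μ) hβ hμ4 hμ0 hθ' hΛ hΛΛ' hΛ'd σ
    have hE1 := sum_norm_sq_fwdDiff_two_time_le (L := L) (M := M) (N := N) (μ := μ) hβ hμ4 hμ0 hθ hΛ hΛβ hΛΛ' hΛ'd hM hMN hM2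
      hB₁ hB₂ σ
    have hE2 := fun i : Fin 2 => sum_norm_sq_fwdDiff_two_space_le (L := L) (M := M) (N := N) (μ := μ) hβ hμ4 hμ0 hθ hΛ hΛβ hΛ1
      hΛΛ' hΛ'd hM1 hB₁ hB₂ σ i
    rw [hc2, ← hFw, ← hSh] at hE0 hE1 hE2
    rw [← hK₁] at hE1
    simp only [← hK₂] at hE2
    set G := gridSymbol L M N β (shiftedSliceSymbol L M β μ θ Λ Λ') σ with hG
    clear_value G
    have hmain := sum_sum_norm_prodChar_le (univ : Finset (Fin 2)) (fun _ : Fin 1 => (1 : ZMod N)) ((s₀ * N / 4) ^ 4)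
      (by positivity) (fun i => (Pi.single i (1 : ZMod L) : TorusSite 2 L)) (fun _ => (Λ * L / 4) ^ 4)
      (fun _ _ => by positivity) 2 G
    simp_rw [weight_eq] at hmain
    refine hmain.trans ?_
    have hQ : ((N : ℝ) ^ 1 * (L : ℝ) ^ 2 *
        (∑ p, ∑ p', ‖G p p'‖ ^ 2 + (s₀ * N / 4) ^ 4 * ∑ p, ∑ p', ‖((fwdDiff (fun _ : Fin 1 => (1 : ZMod N)))^[2] (fun q => G q p')) p‖ ^ 2 +
          ∑ i ∈ (univ : Finset (Fin 2)), (Λ * L / 4) ^ 4 *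
            ∑ p, ∑ p', ‖((fwdDiff (Pi.single i (1 : ZMod L) : TorusSite 2 L))^[2] (G p)) p'‖ ^ 2)) ≤
        32 * N * r ^ 2 * Ktot / (Real.pi * cd * β) := by
      have hs₀N : s₀ * N / 4 = Λ * β / 4 := by rw [hs₀]; field_simp
      rw [hs₀N, pow_one]
      -- each of the three kinds of terms is at most `Fw Sh/(β²L⁴Λ²) × constant`
      have hT0 : ∑ p, ∑ p', ‖G p p'‖ ^ 2 ≤ Fw * Sh / (β ^ 2 * (L : ℝ) ^ 4 * Λ ^ 2) * (64 / 9) := by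
        refine hE0.trans (le_of_eq ?_)
        field_simp
        ring
      have hT1 : (Λ * β / 4) ^ 4 * ∑ p, ∑ p', ‖((fwdDiff (fun _ : Fin 1 => (1 : ZMod N)))^[2] (fun q => G q p')) p‖ ^ 2 ≤
          Fw * Sh / (β ^ 2 * (L : ℝ) ^ 4 * Λ ^ 2) * (3 * (2 * Real.pi) ^ 4 * K₁ ^ 2 / 256) := by
        refine (mul_le_mul_of_nonneg_left hE1 (by positivity)).trans (le_of_eq ?_)
        field_simp
        ring
      have hT2 : ∀ i : Fin 2, (Λ * L / 4) ^ 4 * ∑ p, ∑ p', ‖((fwdDiff (Pi.single i (1 : ZMod L) : TorusSite 2 L))^[2] (G p)) p'‖ ^ 2 ≤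
          Fw * Sh / (β ^ 2 * (L : ℝ) ^ 4 * Λ ^ 2) * (3 * (2 * Real.pi) ^ 4 * K₂ ^ 2 / 256) := by
        intro i
        refine (mul_le_mul_of_nonneg_left (hE2 i) (by positivity)).trans (le_of_eq ?_)
        field_simp
        ring
      have hsum : ∑ p, ∑ p', ‖G p p'‖ ^ 2 + (Λ * β / 4) ^ 4 * ∑ p, ∑ p', ‖((fwdDiff (fun _ : Fin 1 => (1 : ZMod N)))^[2] (fun q => G q p')) p‖ ^ 2 +
          ∑ i ∈ (univ : Finset (Fin 2)), (Λ * L / 4) ^ 4 *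
            ∑ p, ∑ p', ‖((fwdDiff (Pi.single i (1 : ZMod L) : TorusSite 2 L))^[2] (G p)) p'‖ ^ 2 ≤
          Fw * Sh / (β ^ 2 * (L : ℝ) ^ 4 * Λ ^ 2) * Ktot := by
        have h2 : ∑ i ∈ (univ : Finset (Fin 2)), (Λ * L / 4) ^ 4 *
            ∑ p, ∑ p', ‖((fwdDiff (Pi.single i (1 : ZMod L) : TorusSite 2 L))^[2] (G p)) p'‖ ^ 2 ≤
            2 * (Fw * Sh / (β ^ 2 * (L : ℝ) ^ 4 * Λ ^ 2) * (3 * (2 * Real.pi) ^ 4 * K₂ ^ 2 / 256)) := by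
          refine (sum_le_sum fun i _ => hT2 i).trans (le_of_eq ?_)
          rw [sum_const, card_univ, Fintype.card_fin, nsmul_eq_mul, Nat.cast_ofNat]
        calc _ ≤ Fw * Sh / (β ^ 2 * (L : ℝ) ^ 4 * Λ ^ 2) * (64 / 9) +
            Fw * Sh / (β ^ 2 * (L : ℝ) ^ 4 * Λ ^ 2) * (3 * (2 * Real.pi) ^ 4 * K₁ ^ 2 / 256) +
            2 * (Fw * Sh / (β ^ 2 * (L : ℝ) ^ 4 * Λ ^ 2) * (3 * (2 * Real.pi) ^ 4 * K₂ ^ 2 / 256)) :=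
              add_le_add (add_le_add hT0 hT1) h2
          _ = Fw * Sh / (β ^ 2 * (L : ℝ) ^ 4 * Λ ^ 2) * Ktot := by rw [hKtot]; ring
      calc (N : ℝ) * (L : ℝ) ^ 2 * _ ≤ (N : ℝ) * (L : ℝ) ^ 2 * (Fw * Sh / (β ^ 2 * (L : ℝ) ^ 4 * Λ ^ 2) * Ktot) :=
            mul_le_mul_of_nonneg_left hsum (by positivity)
        _ = (N : ℝ) * Ktot / (β ^ 2 * (L : ℝ) ^ 2 * Λ ^ 2) * (Fw * Sh) := by field_simp
        _ ≤ (N : ℝ) * Ktot / (β ^ 2 * (L : ℝ) ^ 2 * Λ ^ 2) * ((4 * Λ' * β / Real.pi) * (8 * Λ' * (L : ℝ) ^ 2 / cd)) :=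
            mul_le_mul_of_nonneg_left hFwSh (by positivity)
        _ = 32 * N * Ktot * Λ' ^ 2 / (Real.pi * cd * β * Λ ^ 2) := by field_simp; ring
        _ ≤ 32 * N * Ktot * (r * Λ) ^ 2 / (Real.pi * cd * β * Λ ^ 2) := by
            gcongr
        _ = 32 * N * r ^ 2 * Ktot / (Real.pi * cd * β) := by field_simp
    -- assemble
    have hPQ : Real.sqrt (∑ a : TorusSite 1 N, ∑ b : TorusSite 2 L,
        (1 + (s₀ * |(((a 0).valMinAbs : ℤ) : ℝ)|) ^ 4 + ∑ i, (Λ * |(((b i).valMinAbs : ℤ) : ℝ)|) ^ 4)⁻¹) *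
        Real.sqrt ((N : ℝ) ^ 1 * (L : ℝ) ^ 2 *
          (∑ p, ∑ p', ‖G p p'‖ ^ 2 + (s₀ * N / 4) ^ 4 * ∑ p, ∑ p', ‖((fwdDiff (fun _ : Fin 1 => (1 : ZMod N)))^[2] (fun q => G q p')) p‖ ^ 2 +
            ∑ i ∈ (univ : Finset (Fin 2)), (Λ * L / 4) ^ 4 *
              ∑ p, ∑ p', ‖((fwdDiff (Pi.single i (1 : ZMod L) : TorusSite 2 L))^[2] (G p)) p'‖ ^ 2)) ≤
        Real.sqrt (2744 * N / (β * Λ ^ 3)) * Real.sqrt (32 * N * r ^ 2 * Ktot / (Real.pi * cd * β)) :=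
      mul_le_mul (Real.sqrt_le_sqrt hP) (Real.sqrt_le_sqrt hQ) (Real.sqrt_nonneg _) (Real.sqrt_nonneg _)
    refine hPQ.trans (le_of_eq ?_)
    have hy : 0 ≤ (N : ℝ) / β / (Λ * Real.sqrt Λ) := by positivity
    have hy2 : ((N : ℝ) / β / (Λ * Real.sqrt Λ)) ^ 2 = (N : ℝ) ^ 2 / (β ^ 2 * Λ ^ 3) := by
      rw [div_pow, div_pow, mul_pow, Real.sq_sqrt hΛ.le]; ring
    rw [← Real.sqrt_mul (by positivity), hC,
      show Real.sqrt (2744 * (32 * r ^ 2 * Ktot / (Real.pi * cd))) * ((N : ℝ) / β) / (Λ * Real.sqrt Λ) =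
        Real.sqrt (2744 * (32 * r ^ 2 * Ktot / (Real.pi * cd))) * ((N : ℝ) / β / (Λ * Real.sqrt Λ)) by ring,
      ← Real.sqrt_sq hy, hy2, ← Real.sqrt_mul (by positivity)]
    congr 1
    field_simp
  refine ⟨fun X => ?_, fun Y => ?_⟩
  · rw [hubbardCovSliceShifted_eq_normalCovariance]
    exact sum_norm_gridSub_pullback_row_le hβ.ne' hMN _ hA X
  · rw [hubbardCovSliceShifted_eq_normalCovariance]
    exact sum_norm_gridSub_pullback_col_le hβ.ne' hMN _ hA Y

end Literature.MathematicalPhysics.QuantumLattice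

end
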